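import Summits.ABC.ABC.Theses.TwistAmplification
import Summits.ABC.ABC.Theorems.TwistAmplificationSomeWindowSavingInertBox
import Summits.ABC.ABC.Theorems.TwistAmplificationTwistAmplificationLemma
import Summits.ABC.ABC.Theorems.TwistAmplificationSomeWindowSavingQuadraticTwistInvariants
import Summits.ABC.ABC.Theorems.TwistAmplificationAssembly
import Literature.NumberTheory.DiophantineGeometry.AbcWave0SUnitProofs

/-!
# Crux `SomeWindowSaving` (stmt-ABC-1976): the CALIBRATION, unconditional

Main results (all unconditional; no named-fact hypotheses):

* `someWindowSaving_iff_cofiniteWeakGenSzpiro` —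
  `SomeWindowSaving ↔ (∃ K N₀, ∀ minimal elliptic W₀/ℤ with c₄ c₆ ≠ 0 and N ≥ N₀, max(|Δ|,|c₄|³) ≤ N^K)`;
* `polynomialABC_of_someWindowSaving` — `SomeWindowSaving → ∃ A C, ∀ abc triples, c ≤ C · rad(abc)^A`
  (the conclusion is verbatim the shared crux `PolynomialABC` of routes CongruentialReceptacle /
  FermatTwistHeights, item stmt-ABC-1724: so crux 1976 dominates crux 1724).

The standing disprover proved the equivalence modulo the route supports `QuadraticTwistInvariants`
(stmt-ABC-1977) and `TwistAmplificationLemma` (stmt-ABC-1978) (`Cruxes/SomeWindowSaving/Disproof.lean` §1).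
Both are now theorems of the tree (`stub_quadraticTwistInvariants` / `quadraticTwistInvariants_proof`,
line polynomial-degree-suffices stub Q, p87180; `twistAmplificationLemma_proof`, p80304), and the ⟸
direction is the landed inert box (`someWindowSaving_of_cofiniteWeakGenSzpiro`, p76658).  Together with the
landed `someWindowSaving_of_abc` the position of the crux is kernel-checked on both sides:

  `ABC ⟹ SomeWindowSaving ⟺ cofinite weak generalized Szpiro ⟹ PolynomialABC (weak abc, ∃-exponent)`.

So the rank-3 crux of route TwistAmplification is EXACTLY cofinite weak generalized Szpiro for non-CM-j
minimal models — Oesterlé's "forme faible" of Szpiro with an unspecified exponent (Sém. Bourbaki 694,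
1988, §2) — and implies weak abc `c < C·rad(abc)^A` (open since Masser–Oesterlé 1985; Bombieri–Gubler
§12.5; every unconditional bound is exponential in a power of the radical, Stewart–Yu 2001).  This file is
the certificate a planner needs to grade the crux conjecture-level.
-/

set_option linter.dupNamespace false

noncomputable section

namespace Summit.ABC.ABC.Theorems

open WeierstrassCurve IsDedekindDomain
open Literature.NumberTheory.DiophantineGeometry
open Summit.ABC.ABC.Theses.TwistAmplification

/-- **(⟹) The crux gives cofinite weak generalized Szpiro**, unconditionally: one application of the
proved amplification lemma (`twistAmplificationLemma_proof`, stmt-ABC-1978) fed with the proved twist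
invariants (`stub_quadraticTwistInvariants` = `QuadraticTwistInvariants`, stmt-ABC-1977) at `σ' := σ + 1`.
[folklore] -/
theorem cofiniteWeakGenSzpiro_of_someWindowSaving (h : SomeWindowSaving) :
    ∃ K N₀ : ℝ, ∀ W₀ : WeierstrassCurve ℤ, (W₀.baseChange ℚ).IsElliptic →
      (∀ v : HeightOneSpectrum ℤ, (W₀.baseChange ℚ).IsMinimalAt v) → W₀.c₄ ≠ 0 → W₀.c₆ ≠ 0 →
        N₀ ≤ (((W₀.baseChange ℚ).conductorNorm ℤ : ℕ) : ℝ) →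
          ((max |W₀.Δ| (|W₀.c₄| ^ 3) : ℤ) : ℝ) ≤ (((W₀.baseChange ℚ).conductorNorm ℤ : ℕ) : ℝ) ^ K := by
  obtain ⟨κ, σ, δ, C, hκ, hκσ, hδ, hcount⟩ := h
  obtain ⟨N₀, hN₀⟩ := twistAmplificationLemma_proof stub_quadraticTwistInvariants κ σ δ C hκ hκσ hδ
    hcount (σ + 1) (by linarith)
  exact ⟨σ + 1, N₀, fun W₀ hE hmin hc₄ hc₆ hN ↦ hN₀ W₀ hE hmin hc₄ hc₆ hN⟩

/-- **CALIBRATION of the crux `SomeWindowSaving` (stmt-ABC-1976), unconditional.**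
`SomeWindowSaving ↔ CofiniteWeakGenSzpiro`: some window `(κ, σ]` past ratio 3 has a count with saving
below the amplification threshold IFF there are `K, N₀` with `max(|Δ|, |c₄|³) ≤ N^K` for every integral
model minimal at all places, elliptic, with `c₄ c₆ ≠ 0` and conductor `N ≥ N₀`.  ⟹ is
`cofiniteWeakGenSzpiro_of_someWindowSaving`; ⟸ is the landed inert box
`someWindowSaving_of_cofiniteWeakGenSzpiro` (window `(K'+1, K'+2]`, `δ = 0`).  Consequently the crux has
exactly the strength of cofinite weak generalized Szpiro (Oesterlé 1988 Conj. 1 forme faible, non-CM-j,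
large conductor) — open.  [folklore] -/
theorem someWindowSaving_iff_cofiniteWeakGenSzpiro :
    Summit.ABC.ABC.Theses.TwistAmplification.SomeWindowSaving ↔
      ∃ K N₀ : ℝ, ∀ W₀ : WeierstrassCurve ℤ, (W₀.baseChange ℚ).IsElliptic →
        (∀ v : IsDedekindDomain.HeightOneSpectrum ℤ, (W₀.baseChange ℚ).IsMinimalAt v) →
          W₀.c₄ ≠ 0 → W₀.c₆ ≠ 0 → N₀ ≤ (((W₀.baseChange ℚ).conductorNorm ℤ : ℕ) : ℝ) →
            ((max |W₀.Δ| (|W₀.c₄| ^ 3) : ℤ) : ℝ) ≤ (((W₀.baseChange ℚ).conductorNorm ℤ : ℕ) : ℝ) ^ K :=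
  ⟨cofiniteWeakGenSzpiro_of_someWindowSaving, someWindowSaving_of_cofiniteWeakGenSzpiro⟩

/-- Sixth-root bookkeeping: `c ≥ 0`, `c⁶ ≤ M · R^K` with `M, R ≥ 0` gives `c ≤ M^{1/6} · R^{K/6}`.
[folklore] -/
theorem SomeWindowSavingCalibration.le_of_pow_six_le {c M R K : ℝ} (hc : 0 ≤ c) (hM : 0 ≤ M)
    (hR : 0 ≤ R) (h : c ^ 6 ≤ M * R ^ K) : c ≤ M ^ (1 / 6 : ℝ) * R ^ (K / 6) := by
  have h5 : c = (c ^ 6) ^ (1 / 6 : ℝ) := by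
    rw [← Real.rpow_natCast c 6, ← Real.rpow_mul hc]; norm_num
  have h6 : (c ^ 6) ^ (1 / 6 : ℝ) ≤ (M * R ^ K) ^ (1 / 6 : ℝ) :=
    Real.rpow_le_rpow (by positivity) h (by norm_num)
  have h7 : (M * R ^ K) ^ (1 / 6 : ℝ) = M ^ (1 / 6 : ℝ) * R ^ (K / 6) := by
    rw [Real.mul_rpow hM (Real.rpow_nonneg hR K), ← Real.rpow_mul hR,
      show K * (1 / 6 : ℝ) = K / 6 by ring]
  rw [h5]; exact h6.trans_eq h7

/-- **The crux implies polynomial (weak) abc**: `SomeWindowSaving → ∃ A C, ∀ abc triples (a,b,c),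
c ≤ C · rad(abc)^A`.  The conclusion is VERBATIM the shared crux `PolynomialABC` of routes
`CongruentialReceptacle` (rank 3) and `FermatTwistHeights` (item stmt-ABC-1724), i.e. weak abc with an
unspecified exponent (open since Masser–Oesterlé 1985).  Proof (Bombieri–Gubler Thm. 12.5.12 (c) ⟹ (a)
pattern, as in `TwistAmplificationAssembly.abc_of_cofinite_genSzpiro`): take `(K, N₀)` from
`cofiniteWeakGenSzpiro_of_someWindowSaving`, `K' := max K 0`; an abc triple with `a ≠ b` has a global
minimal Frey model (`TwistAmplificationAssembly.exists_frey_model`: `N ∣ 2¹⁰ rad`, `c² ≤ 2|c₄|`,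
`c₆ ≠ 0`, odd primes of `abc` divide `N`); if `N ≥ N₀` then `c⁶ ≤ 8|c₄|³ ≤ 8N^{K'} ≤ 8(2¹⁰rad)^{K'}`;
if `N < N₀` every prime of `abc` is `< ⌈N₀⌉₊ + 3`, so by Mahler (`finite_setOf_isABCTriple_primeFactors_subset_holds`)
`c ≤ B`; the triple `(1,1,2)` has `c = 2`.  [cite: BombieriGubler2006, Thm. 12.5.12] -/
theorem polynomialABC_of_someWindowSaving (h : SomeWindowSaving) :
    ∃ A C : ℝ, ∀ a b c : ℕ, IsABCTriple a b c → (c : ℝ) ≤ C * ((rad a b c : ℕ) : ℝ) ^ A := by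
  obtain ⟨K, N₀, hN₀⟩ := cofiniteWeakGenSzpiro_of_someWindowSaving h
  set K' : ℝ := max K 0 with hK'def
  have hK'0 : 0 ≤ K' := le_max_right _ _
  -- the large-conductor constant
  set M : ℝ := 8 * ((2 : ℝ) ^ 10) ^ K' with hMdef
  have hM0 : 0 ≤ M := by positivity
  -- the small-conductor bound (Mahler)
  set S : Finset ℕ := Finset.range (⌈N₀⌉₊ + 3) with hSdef
  have hfin : {t : ℕ × ℕ × ℕ | IsABCTriple t.1 t.2.1 t.2.2 ∧
      (t.1 * t.2.1 * t.2.2).primeFactors ⊆ S}.Finite :=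
    finite_setOf_isABCTriple_primeFactors_subset_holds S
  obtain ⟨B, hB⟩ := (hfin.image (fun t : ℕ × ℕ × ℕ ↦ t.2.2)).bddAbove
  set C₀ : ℝ := max (max (M ^ (1 / 6 : ℝ)) (B : ℝ)) 2 with hC₀def
  have hC₀0 : 0 ≤ C₀ := zero_le_two.trans (le_max_right _ _)
  refine ⟨K' / 6, C₀, fun a b c ht ↦ ?_⟩
  set R : ℝ := ((rad a b c : ℕ) : ℝ) with hRdef
  have hR1 : 1 ≤ R := by
    rw [hRdef, rad_def]; exact_mod_cast Nat.radical_pos _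
  have hR0 : 0 ≤ R := zero_le_one.trans hR1
  have hRpow1 : 1 ≤ R ^ (K' / 6) := Real.one_le_rpow hR1 (by positivity)
  have hC₀R : C₀ ≤ C₀ * R ^ (K' / 6) := le_mul_of_one_le_right hC₀0 hRpow1
  by_cases hab : a = b
  · -- the triple `(1, 1, 2)`
    obtain ⟨-, -, habc, hcop⟩ := ht
    subst hab
    have ha1 : a = 1 := by simpa using hcop
    subst ha1
    have hc2 : (c : ℝ) = 2 := by rw [← habc]; norm_num
    have : (2 : ℝ) ≤ C₀ := le_max_right _ _
    linarith
  obtain ⟨W₀, hE, hmin, hN, hc₄, hc₆, hdvd⟩ := TwistAmplificationAssembly.exists_frey_model ht hab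
  haveI := hE
  have hc : 0 < c := by obtain ⟨ha, -, habc, -⟩ := ht; omega
  set N : ℝ := (((W₀.baseChange ℚ).conductorNorm ℤ : ℕ) : ℝ) with hNdef
  have hNpos : 0 < (W₀.baseChange ℚ).conductorNorm ℤ := conductorNorm_pos_holds _
  have hN1 : (1 : ℝ) ≤ N := by rw [hNdef]; exact_mod_cast hNpos
  by_cases hsmall : N < N₀
  · -- small conductor: all prime factors of `abc` lie in `S`, so `c ≤ B`
    have hmem : (a, b, c) ∈ {t : ℕ × ℕ × ℕ | IsABCTriple t.1 t.2.1 t.2.2 ∧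
        (t.1 * t.2.1 * t.2.2).primeFactors ⊆ S} := by
      refine ⟨ht, fun p hp ↦ ?_⟩
      have hpp : p.Prime := Nat.prime_of_mem_primeFactors hp
      have hpd : p ∣ a * b * c := Nat.dvd_of_mem_primeFactors hp
      rw [hSdef, Finset.mem_range]
      by_cases hp2 : p = 2
      · omega
      have hpN : p ∣ (W₀.baseChange ℚ).conductorNorm ℤ := hdvd p hpp hpd hp2
      have hple : (p : ℝ) ≤ N := by rw [hNdef]; exact_mod_cast Nat.le_of_dvd hNpos hpN
      have hplt : (p : ℝ) < (⌈N₀⌉₊ : ℝ) := (hple.trans_lt hsmall).trans_le (Nat.le_ceil _)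
      have : p < ⌈N₀⌉₊ := by exact_mod_cast hplt
      omega
    have hcB : c ≤ B := hB (Set.mem_image_of_mem (fun t : ℕ × ℕ × ℕ ↦ t.2.2) hmem)
    have hcB' : (c : ℝ) ≤ C₀ :=
      ((Nat.cast_le.mpr hcB).trans (le_max_right _ _)).trans (le_max_left _ _)
    exact hcB'.trans hC₀R
  · -- large conductor: `c⁶ ≤ 8 |c₄|³ ≤ 8 N^{K'} ≤ M rad^{K'}`
    push Not at hsmall
    have hc₄0 : W₀.c₄ ≠ 0 := by
      intro h0
      rw [h0, abs_zero, mul_zero] at hc₄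
      have : (0 : ℤ) < (c : ℤ) ^ 2 := by positivity
      linarith
    have key := hN₀ W₀ hE hmin hc₄0 hc₆ hsmall
    have h1 : |(W₀.c₄ : ℝ)| ^ 3 ≤ N ^ K' := by
      have key' : max |(W₀.Δ : ℝ)| (|(W₀.c₄ : ℝ)| ^ 3) ≤ N ^ K := by
        rw [hNdef]; exact_mod_cast key
      exact (le_of_max_le_right key').trans (Real.rpow_le_rpow_of_exponent_le hN1 (le_max_left _ _))
    have h2 : N ≤ 2 ^ 10 * R := by
      have := Nat.le_of_dvd (mul_pos (by positivity) (by rw [rad_def]; exact Nat.radical_pos _)) hN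
      rw [hNdef, hRdef]; exact_mod_cast this
    have hN0 : 0 ≤ N := by rw [hNdef]; positivity
    have h3 : (c : ℝ) ^ 6 ≤ M * R ^ K' := by
      have hc2 : (c : ℝ) ^ 2 ≤ 2 * |(W₀.c₄ : ℝ)| := by exact_mod_cast hc₄
      calc (c : ℝ) ^ 6 = ((c : ℝ) ^ 2) ^ 3 := by ring
        _ ≤ (2 * |(W₀.c₄ : ℝ)|) ^ 3 := pow_le_pow_left₀ (by positivity) hc2 3
        _ = 8 * |(W₀.c₄ : ℝ)| ^ 3 := by ring
        _ ≤ 8 * N ^ K' := by linarith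
        _ ≤ 8 * (2 ^ 10 * R) ^ K' := by gcongr
        _ = M * R ^ K' := by rw [hMdef, Real.mul_rpow (by positivity) hR0]; ring
    have h8 := SomeWindowSavingCalibration.le_of_pow_six_le (Nat.cast_nonneg c) hM0 hR0 h3
    have hMC : M ^ (1 / 6 : ℝ) ≤ C₀ := (le_max_left _ _).trans (le_max_left _ _)
    exact h8.trans (mul_le_mul_of_nonneg_right hMC (by positivity))

end Summit.ABC.ABC.Theorems

end
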